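import Mathlib.Analysis.Fourier.LpSpace
import Mathlib.Analysis.InnerProductSpace.PiL2
import Literature.Analysis.FunctionSpaces.FourierSobolevNorm
import Literature.Analysis.FunctionSpaces.Complexify
import Literature.Analysis.FluidPDE.HelicalSectorSeminorm
import HarnessLib

/-!
# Helical sectors II: sector vorticities, the transfer parallelepiped, one-sector Serrin classes

Analysis/FluidPDE definitions file (definitions + algebraic sanity lemmas only: no named fact, no
regularity statement), continuing `Literature.Analysis.FluidPDE.HelicalSectorSeminorm`.
Sources: N. Lerner, F. Vigneron, arXiv:2203.07950 [LernerVigneron2022] §3, Prop. 14 p. 17 (the balance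
laws of the two helical sectors `½ d/dt h_σ + ν d_σ = -τ`, BOTH driven by the single TRANSFER TERM
`τ = ∫ det(ω₋, u, ω₊) dx`, `ω_σ = curl u^σ`; Thm 9 p. 10, Thm 11 p. 13, Thm 13 p. 14: one-sector
criticality criteria); F. Waleffe, Phys. Fluids A 4 (1992) 350–363 [Waleffe1992] (`i k × h_s = s k h_s`);
A. Farhat, Z. Grujić, arXiv:1804.08238 [FarhatGrujic2018] Thm 1 (local near-Beltrami depletion
`|sin ∠(u, ω)| ≤ c |u|` prevents blow-up — the two-vector ancestor of the three-vector degeneracy below);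
T. Kato, G. Ponce, Comm. Pure Appl. Math. 41 (1988) [KatoPonce1988] and H. Bahouri, J.-Y. Chemin,
R. Danchin [BahouriCheminDanchin2011] Thm 1.38 (the scale `Ḣ^{1/2+2/r} ⊂ …`, Sobolev–Serrin classes
`L^r_t Ḣ^{1/2+2/r}_x`, `2/r + (3/2 - (1/2+2/r)) … ` scale-invariant for every `r`); J.-Y. Chemin, P. Zhang
[CheminZhang2016] (one-COMPONENT criterion in `L^r_t Ḣ^{1/2+2/r}_x` — the Cartesian analogue of the
one-SECTOR classes recorded here).

This file records, over the vocabulary of `HelicalSectorSeminorm` (`icross`, `spinSymbol`, `fourierL2`,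
`eSeminormSq`):

* `HelicalSector.curlSymbol σ v ξ = 2π · iξ × (Q_σ(ξ) 𝓕v(ξ))` — the Fourier symbol of the spin-`σ`
  SECTOR VORTICITY `ω_σ = curl u^σ` in Mathlib's normalisation (`𝓕(∂_j w) = 2πi ξ_j 𝓕w`); junk `0`
  off `L²` through `fourierL2`;
* `HelicalSector.sectorCurl σ v` — `ω_σ` itself as an a.e.-defined function, the inverse Plancherel
  transform (`𝓕⁻` on `Lp _ 2`, `MeasureTheory.Lp.fourierTransformₗᵢ`) of the symbol; **junk `0`** when
  the symbol is not in `L²` (i.e. `u^σ ∉ Ḣ¹`) — every use below is GUARDED by that membership;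
* `HelicalSector.det3 a b c = a · (b × c)` on `ℂ³` (the integrand of `τ` is `det3 ω₋ u ω₊`), with the
  alternating / cyclic sanity lemmas;
* CELL PREDICATES for regularity statements graded by the GEOMETRY of the transfer term:
  `HelicalSector.TransferDegenerateOn θ u t₁ T` — on every slice `t ∈ [t₁,T)` the slice and both sector
  vorticities are genuine `L²` objects and `|det(ω₋,u,ω₊)| ≤ θ |ω₋| |u| |ω₊|` a.e. (`θ = 1`: no
  condition, by Hadamard; `θ = 0`: the parallelepiped is flat a.e., e.g. Beltrami / homochiral slices);
  `HelicalSector.AsymptoticallyDegenerateTransfer u T` — for every `ε > 0` a tail `[t₁,T)` and a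
  `θ ≥ 0` with `θ · ‖u(t₁)‖_{Ḣ^{1/2}} ≤ ε` (product in `ℝ≥0∞`, `Function.eHomSobolevSeminorm`) on which
  the transfer is `θ`-degenerate — the dimensionless grade `θ ‖u‖_{Ḣ^{1/2}}` stated WITHOUT any
  embedding constant;
* CELL PREDICATE for statements graded by the SIZE of one sector in the Sobolev–Serrin scale:
  `HelicalSector.SerrinSectorOn σ r u T` — `∫₀ᵀ (‖u^σ(t)‖²_{Ḣ^{1/2+2/r}})^{r/2} dt < ∞`, certified by a
  measurable integrable majorant exactly as `DissipationFiniteOn` (which is the case `r = 2`).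

Design: plain `def`s over Mathlib + the tree's Fourier–Sobolev files; no `instance`, no `notation`;
nothing is assumed divergence-free.
-/

noncomputable section

open MeasureTheory
open scoped ENNReal NNReal FourierTransform

namespace Literature.Analysis.FluidPDE.HelicalSector

open Literature.Analysis.FunctionSpaces
open Literature.Analysis.FunctionSpaces.EuclideanSpace (complexify)

/-! ### Sector vorticities -/

/-- Fourier symbol of the spin-`σ` SECTOR VORTICITY `ω_σ = curl (Q_σ v)`: with Mathlib's `𝓕` (kernel
`e^{-2πi⟪x,ξ⟫}`) `𝓕(curl w)(ξ) = 2π · iξ × 𝓕w(ξ)`, so the symbol is `2π · icross ξ (Q_σ(ξ) 𝓕v(ξ))`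
(junk `0` off `L²` through `fourierL2`). [cite: LernerVigneron2022, Prop. 14, p. 17] -/
def curlSymbol (σ : ℝ) (v : EuclideanSpace ℝ (Fin 3) → EuclideanSpace ℝ (Fin 3)) :
    EuclideanSpace ℝ (Fin 3) → EuclideanSpace ℂ (Fin 3) :=
  fun ξ => ((2 * Real.pi : ℝ) : ℂ) • icross ξ (spinSymbol σ ξ (fourierL2 v ξ))

/-- The spin-`σ` SECTOR VORTICITY `ω_σ(x)` as an a.e.-defined `L²` function: the inverse Plancherel
transform `𝓕⁻` (on `Lp _ 2`) of `curlSymbol σ v`; **junk value `0`** when the symbol is not in `L²`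
(`Q_σ v ∉ Ḣ¹`).  To be used only under `∀ᵐ x` and together with the membership guards of
`TransferDegenerateOn`. [cite: LernerVigneron2022, Prop. 14, p. 17] -/
def sectorCurl (σ : ℝ) (v : EuclideanSpace ℝ (Fin 3) → EuclideanSpace ℝ (Fin 3)) :
    EuclideanSpace ℝ (Fin 3) → EuclideanSpace ℂ (Fin 3) :=
  open scoped Classical in
  if h : MemLp (curlSymbol σ v) 2 (volume : Measure (EuclideanSpace ℝ (Fin 3))) then
    ((𝓕⁻ (h.toLp (curlSymbol σ v)) : Lp (EuclideanSpace ℂ (Fin 3)) 2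
      (volume : Measure (EuclideanSpace ℝ (Fin 3)))) : EuclideanSpace ℝ (Fin 3) → EuclideanSpace ℂ (Fin 3))
  else 0

/-! ### The transfer parallelepiped -/

/-- The (complex) scalar triple product `det(a, b, c) = a · (b × c)` of three vectors of `ℂ³`; the integrand
of Lerner–Vigneron's transfer term is `det3 ω₋ u ω₊`. [cite: LernerVigneron2022, Prop. 14, p. 17] -/
def det3 (a b c : EuclideanSpace ℂ (Fin 3)) : ℂ :=
  a 0 * (b 1 * c 2 - b 2 * c 1) - a 1 * (b 0 * c 2 - b 2 * c 0) + a 2 * (b 0 * c 1 - b 1 * c 0)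

/-- CELL PREDICATE — the transfer parallelepiped of the time-dependent field `u` is `θ`-DEGENERATE on the
tail `[t₁, T)`: at every such time the slice and both sector vorticities are genuine `L²` objects (guards —
no junk) and `|det(ω₋, u, ω₊)| ≤ θ · |ω₋| |u| |ω₊|` almost everywhere: the normalised volume spanned by
`ω₋(x), u(x), ω₊(x)` is at most `θ` (`θ = 1` is no condition by Hadamard's inequality; `θ = 0` means the three
vectors are coplanar a.e.).  Three-vector, sector-resolved form of the near-Beltrami depletion condition
`|u × ω| ≤ c |u|²…` of Farhat–Grujić. [cite: FarhatGrujic2018, Thm 1] -/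
def TransferDegenerateOn (θ : ℝ) (u : ℝ → EuclideanSpace ℝ (Fin 3) → EuclideanSpace ℝ (Fin 3))
    (t₁ T : ℝ) : Prop :=
  ∀ t ∈ Set.Ico t₁ T,
    MemLp (complexify ∘ u t) 2 (volume : Measure (EuclideanSpace ℝ (Fin 3))) ∧
    MemLp (curlSymbol 1 (u t)) 2 (volume : Measure (EuclideanSpace ℝ (Fin 3))) ∧
    MemLp (curlSymbol (-1) (u t)) 2 (volume : Measure (EuclideanSpace ℝ (Fin 3))) ∧
    ∀ᵐ x ∂(volume : Measure (EuclideanSpace ℝ (Fin 3))),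
      ‖det3 (sectorCurl (-1) (u t) x) (complexify (u t x)) (sectorCurl 1 (u t) x)‖ ≤
        θ * (‖sectorCurl (-1) (u t) x‖ * ‖u t x‖ * ‖sectorCurl 1 (u t) x‖)

/-- CELL PREDICATE — ASYMPTOTICALLY DEGENERATE TRANSFER GEOMETRY at the critical scale: for every `ε > 0`
there are a time `t₁ ∈ [0,T)` and a `θ ≥ 0` with `θ · ‖u(t₁)‖_{Ḣ^{1/2}} ≤ ε` such that the transfer
parallelepiped is `θ`-degenerate on `[t₁, T)` (the `liminf = 0` cell of the dimensionless grade
`θ ‖u‖_{Ḣ^{1/2}}`, stated without any embedding constant; with `θ = 0`, `0 · ⊤ = 0` in `ℝ≥0∞` so an exactly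
flat tail qualifies whatever the size of the flow). [cite: FarhatGrujic2018, Thm 1] -/
def AsymptoticallyDegenerateTransfer (u : ℝ → EuclideanSpace ℝ (Fin 3) → EuclideanSpace ℝ (Fin 3))
    (T : ℝ) : Prop :=
  ∀ ε : ℝ, 0 < ε → ∃ t₁ ∈ Set.Ico 0 T, ∃ θ : ℝ, 0 ≤ θ ∧
    ENNReal.ofReal θ * Function.eHomSobolevSeminorm (1 / 2 : ℝ) (complexify ∘ u t₁) ≤ ENNReal.ofReal ε ∧
    TransferDegenerateOn θ u t₁ T

/-! ### One-sector Sobolev–Serrin classes -/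

/-- CELL PREDICATE — the spin-`σ` sector lies in the SOBOLEV–SERRIN class of exponent `r`:
`∫₀ᵀ ‖u^σ(t)‖^r_{Ḣ^{1/2+2/r}} dt < ∞` (the squared sector seminorm `eSeminormSq σ (1/2+2/r)` raised to the
real power `r/2`), certified by a measurable integrable majorant (no junk in the time integral).  Scale
invariant for every `r`; `r = 2` is `DissipationFiniteOn σ u T` (`serrinSectorOn_two_iff`); the formal endpoint
`r = ∞` corresponds to `CriticallyBoundedOn`.  The Cartesian one-component analogue is the
Chemin–Zhang class. [cite: CheminZhang2016, Thm 1.1] -/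
def SerrinSectorOn (σ r : ℝ) (u : ℝ → EuclideanSpace ℝ (Fin 3) → EuclideanSpace ℝ (Fin 3)) (T : ℝ) :
    Prop :=
  ∃ g : ℝ → ℝ≥0∞, Measurable g ∧
    (∀ t ∈ Set.Ioo 0 T, (eSeminormSq σ (1 / 2 + 2 / r) (u t)) ^ (r / 2) ≤ g t) ∧
    (∫⁻ t in Set.Ioo 0 T, g t) < ⊤

/-! ### Sanity lemmas -/

/-- The scalar triple product is alternating: it vanishes when the first two arguments coincide.
[cite: LernerVigneron2022, Prop. 14, p. 17] -/
theorem det3_self_left (a c : EuclideanSpace ℂ (Fin 3)) : det3 a a c = 0 := by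
  simp only [det3]; ring

/-- … and when the last two coincide. [cite: LernerVigneron2022, Prop. 14, p. 17] -/
theorem det3_self_right (a b : EuclideanSpace ℂ (Fin 3)) : det3 a b b = 0 := by
  simp only [det3]; ring

/-- Cyclic invariance `det(a,b,c) = det(b,c,a)` (so `det(ω₋,u,ω₊) = u · (ω₊ × ω₋)`).
[cite: LernerVigneron2022, Prop. 14, p. 17] -/
theorem det3_cyclic (a b c : EuclideanSpace ℂ (Fin 3)) : det3 a b c = det3 b c a := by
  simp only [det3]; ring

/-- Swapping two arguments changes the sign. [cite: LernerVigneron2022, Prop. 14, p. 17] -/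
theorem det3_swap (a b c : EuclideanSpace ℂ (Fin 3)) : det3 a b c = -det3 c b a := by
  simp only [det3]; ring

/-- Degeneracy is monotone in `θ`. [cite: FarhatGrujic2018, Thm 1] -/
theorem TransferDegenerateOn.mono {θ θ' : ℝ} (hθ : θ ≤ θ')
    {u : ℝ → EuclideanSpace ℝ (Fin 3) → EuclideanSpace ℝ (Fin 3)} {t₁ T : ℝ}
    (h : TransferDegenerateOn θ u t₁ T) : TransferDegenerateOn θ' u t₁ T := by
  intro t ht
  obtain ⟨h2, hp, hm, hae⟩ := h t ht
  refine ⟨h2, hp, hm, ?_⟩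
  filter_upwards [hae] with x hx
  exact hx.trans (mul_le_mul_of_nonneg_right hθ (by positivity))

/-- Degeneracy on a tail restricts to later tails. [cite: FarhatGrujic2018, Thm 1] -/
theorem TransferDegenerateOn.of_le {θ : ℝ} {u : ℝ → EuclideanSpace ℝ (Fin 3) → EuclideanSpace ℝ (Fin 3)}
    {t₁ t₂ T : ℝ} (h12 : t₁ ≤ t₂) (h : TransferDegenerateOn θ u t₁ T) : TransferDegenerateOn θ u t₂ T :=
  fun t ht => h t ⟨h12.trans ht.1, ht.2⟩

/-- An EXACTLY flat tail (`θ = 0`) is asymptotically degenerate whatever the size of the flow.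
[cite: FarhatGrujic2018, Thm 1] -/
theorem asymptoticallyDegenerateTransfer_of_zero
    {u : ℝ → EuclideanSpace ℝ (Fin 3) → EuclideanSpace ℝ (Fin 3)} {t₁ T : ℝ} (ht₁ : t₁ ∈ Set.Ico 0 T)
    (h : TransferDegenerateOn 0 u t₁ T) : AsymptoticallyDegenerateTransfer u T := by
  intro ε _
  exact ⟨t₁, ht₁, 0, le_rfl, by simp [ENNReal.ofReal_zero], h⟩

/-- The exponent-`2` Serrin sector class is the finite-dissipation cell of `HelicalSectorSeminorm`.
[cite: LernerVigneron2022, Prop. 14, p. 17] -/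
theorem serrinSectorOn_two_iff (σ : ℝ) (u : ℝ → EuclideanSpace ℝ (Fin 3) → EuclideanSpace ℝ (Fin 3))
    (T : ℝ) : SerrinSectorOn σ 2 u T ↔ DissipationFiniteOn σ u T := by
  have hs : (1 / 2 + 2 / 2 : ℝ) = 3 / 2 := by norm_num
  have hr : ((2 : ℝ) / 2) = 1 := by norm_num
  unfold SerrinSectorOn DissipationFiniteOn
  rw [hs, hr]
  simp only [ENNReal.rpow_one]

end Literature.Analysis.FluidPDE.HelicalSector
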